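import Literature.MathematicalPhysics.QuantumFieldTheory.Balaban1983to89.B8Eq138LandauZd
import Literature.MathematicalPhysics.QuantumFieldTheory.Balaban1983to89.B8Thm4TorusAt
import HarnessLib

/-!
# Route «BalabanUVNodes» (K3 `SpineGivenEndpointR11`), DAG node N16 = NE3 — TRANSLATION COVARIANCE OF THE `ℤᵈ` STENCILS OF [B8] THEOREM 4
# BY THE PERIOD LATTICE `Lʲ·ℤᵈ`: the block geometry, the background transporters `bgT`, the nonlinear gauge average `R̄₀uʲ` ((1.29),
# `Restr129` on the all-torus constraint sets `torusLam`), the covariant stencils `D^η_{U₀}`, `D^{η*}_{U₀}`, `Δ^η_{U₀}`, the transpose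
# averaging `Q′(U₀)ᵀ` and (1.38) `IsLandau138` on `Ω₀ = ℤᵈ`

Cell `pub-ymgap`, seat `pub-ymgap-dag-n16-c` (R134 fan-out seat, strategy s1; HUMAN RULING D-0062; chair R424 venue), generation 0, file 1;
`--supports stmt-QuantumFields-19676`; `bears_on: R4∕N16 · edge N05 → N16`.

WHY.  N16's only N05-side hypothesis is print's [Balaban1985RegularSpaces] Theorem 4 in the all-torus geometry, typed by seat n16-b as the
interface `B8Thm4TorusAt.Thm4TorusAt L k P η c₁ G Reg Restr Concl` (periodic data, a periodic gauge, uniqueness among periodic gauges;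
`P = N·Lᵏ`).  The companion file `BalabanUVNodesN16Thm4TorusOfZd` proves the PERIODICITY PRINCIPLE: the same interface AT PERIOD `0` (no
periodicity anywhere, uniqueness among ALL `G`-valued gauges — the `ℤᵈ` reading of node N05's carriers and of the D-0062 desk's
`Thm4AllTorus`) already implies the periodic statement, because a translate of a solution is a solution.  That argument needs exactly the
facts of this file: every predicate entering `Restr`∕`Concl` is COVARIANT under translations of all its arguments by a vector of the period
lattice, the level-`j` objects being translated by `a` when the fine lattice is translated by `Lʲ·a`.

WHAT THIS FILE PROVES (kernel, theorems only, 0 `def`, 0 sorry; elementary API over the Literature stencils, [folklore] throughout):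
§1 block geometry: `blockMap_add_smul` (`⌊(x + L·a)∕L⌋ = ⌊x∕L⌋ + a`), `blockBase_add`, `sum_blockSites_add` (re-indexing a block sum);
§2 `axialFn_shiftCfg`, `bgT_shiftCfg` (the transporters `Ū₀ʲ(Γ_{Ly,x})` of (79)–(80) of [Balaban1985Averaging]);
§3 `Rbar_bgT_shiftCfg` — `R̄₀(t_{Lʲa}u)ʲ(y) = R̄₀uʲ(y + a)` relative to `t_{Lʲa}U₀` — and **`restr129_torusLam_shiftCfg`**: (1.29) on the all-torus
   constraint sets `torusLam k` is invariant under `u ↦ t_{Lᵏa}u` for an `Lᵏa`-periodic background;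
§4 `covDerivFwd_shiftCfg`, `covDeriv_shiftCfg`, `covDivB_shiftCfg(_eq)`, `covLap_shiftCfg` (joint covariance of the covariant stencils), `cfgExp_shiftCfg`;
§5 `qprimeT1_shiftCfg`, `QprimeT_shiftCfg`, `QT_torusLam_shiftCfg` (the transpose averaging `Q′(U₀)ᵀ` of [Balaban1985BackgroundPropagators]
   (3.19)∕(3.24)) and **`isLandau138_torusLam_shiftCfg`**: (1.38) in multiplier form on `Ω₀ = univ` with the all-torus constraint sets is
   invariant under `A ↦ t_{Lᵏa}A` for an `Lᵏa`-periodic background (the multiplier is translated level by level).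
HONEST FRAMING: bookkeeping (translation covariance of definitions); nothing of [B8] is proved; Theorem 4 at curved backgrounds = node N05,
NOT proved; N16 ∕ NE3 NOT discharged; count-neutral; finite T⁴ at fixed ε — NOT ℝ⁴, NOT infinite volume, NOT OS, NOT a mass gap, NOT Clay.
-/

set_option autoImplicit false

open scoped BigOperators
open Finset

namespace Summit.QuantumFields.YangMills.BalabanUVNodes.N16.TorusShift

open Literature.MathematicalPhysics.QuantumFieldTheory.Balaban1983to89
open B7Prop1Explicit B7Prop2Explicit
open B7Eq78Linearization (conjR conjR_apply Rbar Rbar_zero Rbar_succ zdBlocking avgStep)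
open B7BlockAvgLog (barAvg)
open B8Ineq132 (covDeriv covDerivFwd)
open B8Eq119TwistedAxial (bgT Restr129 blockBase_eq_smul)
open B8Eq138LandauZd (covDivB covLap qprimeT1 QprimeT QT IsLandau138)
open B8Eq184Proof (cfgExp)
open B8Thm4TorusAt (torusLam mem_torusLam_iff)
open B12Ineq417Flat (shiftCfg shiftCfg_apply hol_shiftCfg)
open B7TranslationCovariance (shiftCfg_avgIter)
open Literature.MathematicalPhysics.QuantumLattice (blockMap blockBase blockSites)

noncomputable section

variable {d : ℕ}

/-! ## §1 Block geometry under translations by `L·a` -/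

/-- **`⌊(x + L·a)∕L⌋ = ⌊x∕L⌋ + a`**: translating the fine lattice by `L·a` translates the block labels by `a` (`L ≥ 1`). [folklore] -/
theorem blockMap_add_smul {L : ℕ} (hL : 1 ≤ L) (x a : Site d) :
    blockMap L (x + (L : ℤ) • a) = blockMap L x + a := by
  have hL0 : (L : ℤ) ≠ 0 := by exact_mod_cast (show L ≠ 0 by omega)
  funext i
  simp only [blockMap, Pi.add_apply, Pi.smul_apply, smul_eq_mul]
  rw [Int.add_mul_ediv_left _ _ hL0]

/-- The block corner of the translated label: `L·(y + a) = L·y + L·a`. [folklore] -/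
theorem blockBase_add (L : ℕ) (y a : Site d) : blockBase L (y + a) = blockBase L y + (L : ℤ) • a := by
  rw [blockBase_eq_smul, blockBase_eq_smul, smul_add]

/-- **Re-indexing a block sum**: summing `g` over the block `B(y + a)` is summing `g(· + L·a)` over `B(y)`. [folklore] -/
theorem sum_blockSites_add {β : Type*} [AddCommMonoid β] (L : ℕ) (y a : Site d) (g : Site d → β) :
    ∑ x ∈ blockSites L (y + a), g x = ∑ x ∈ blockSites L y, g (x + (L : ℤ) • a) := by
  classical
  have hinj : ∀ z : Site d, Set.InjOn (fun t : Fin d → ℕ => z + fun i => (t i : ℤ))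
      ↑(Fintype.piFinset fun _ : Fin d => range L) := by
    intro z t _ t' _ h
    funext i
    have := congr_fun h i
    simpa using this
  unfold blockSites
  rw [Finset.sum_image (hinj _), Finset.sum_image (hinj _)]
  refine Finset.sum_congr rfl fun t _ => ?_
  rw [blockBase_add, add_right_comm]

/-! ## §2 The background transporters under translations -/

/-- The complete axial gauge function (78) of [Balaban1985Averaging] is translation covariant: `(t_v V)(Γ_{y,x}) = V(Γ_{y+v,x+v})`. [folklore] -/
theorem axialFn_shiftCfg {G : Type*} [Group G] (V : Site d → Fin d → G) (v y x : Site d) :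
    axialFn (shiftCfg v V) y x = axialFn V (y + v) (x + v) := by
  simp only [axialFn, hol_shiftCfg, add_sub_add_right_eq_sub]

variable {𝔸 : Type*} [NormedRing 𝔸] [NormOneClass 𝔸] [NormedAlgebra ℂ 𝔸] [CompleteSpace 𝔸]

omit [NormOneClass 𝔸] in
/-- **The level-`j` background transporters are translation covariant**: translating `U₀` by `Lʲ·(L·a)` on the fine lattice translates
`T_j(y, x) = Ū₀ʲ(Γ_{Ly,x})` by `a` in the block label and by `L·a` in the level-`j` site ([Balaban1985Averaging] (43)'s covariance,
`B7TranslationCovariance.shiftCfg_avgIter`). [folklore] -/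
theorem bgT_shiftCfg (L : ℕ) (U₀ : Site d → Fin d → 𝔸ˣ) (j : ℕ) (a y x : Site d) :
    bgT L (shiftCfg (((L : ℤ) ^ j) • ((L : ℤ) • a)) U₀) j y x = bgT L U₀ j (y + a) (x + (L : ℤ) • a) := by
  unfold bgT
  rw [← shiftCfg_avgIter, axialFn_shiftCfg, blockBase_add]

/-! ## §3 The nonlinear gauge average `R̄₀uʲ` and (1.29) on the all-torus constraint sets -/

omit [NormOneClass 𝔸] [CompleteSpace 𝔸] in
/-- One step (78)∕(80) of [Balaban1985Averaging] over a translated block: with transporters, base value and variables all read at `· + L·a`,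
the twisted block average over `B(y)` is the one over `B(y + a)`. [folklore] -/
theorem avgStep_blockSites_add (L : ℕ) (y a : Site d) (T : Site d → 𝔸ˣ) (vy : 𝔸) (v : Site d → 𝔸) :
    avgStep (blockSites L y) (fun _ => ((L : ℝ) ^ d)⁻¹) (fun x => T (x + (L : ℤ) • a)) vy (fun x => v (x + (L : ℤ) • a)) =
      avgStep (blockSites L (y + a)) (fun _ => ((L : ℝ) ^ d)⁻¹) T vy v := by
  unfold avgStep barAvg
  rw [sum_blockSites_add]

omit [NormOneClass 𝔸] in
/-- **`R̄₀(t_{Lʲa}u)ʲ(y) = R̄₀uʲ(y + a)`** (the `j`-th order nonlinear average (79)–(80) of [Balaban1985Averaging] for gauge transformations,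
relative to the translated background `t_{Lʲa}U₀`): translation covariance of `B7Eq78Linearization.Rbar` on the `ℤᵈ` blocks with the
transporters `bgT`. [folklore] -/
theorem Rbar_bgT_shiftCfg (L : ℕ) (U₀ : Site d → Fin d → 𝔸ˣ) :
    ∀ (j : ℕ) (a : Site d) (f : Site d → 𝔸) (y : Site d),
      Rbar (zdBlocking d L) (bgT L (shiftCfg (((L : ℤ) ^ j) • a) U₀)) j (shiftCfg (((L : ℤ) ^ j) • a) f) y =
        Rbar (zdBlocking d L) (bgT L U₀) j f (y + a)
  | 0, a, f, y => by simp [shiftCfg_apply]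
  | j + 1, a, f, y => by
    have hs : ((L : ℤ) ^ (j + 1)) • a = ((L : ℤ) ^ j) • ((L : ℤ) • a) := by rw [smul_smul, ← pow_succ]
    rw [Rbar_succ, Rbar_succ]
    show avgStep (blockSites L y) (fun _ => ((L : ℝ) ^ d)⁻¹) (bgT L (shiftCfg (((L : ℤ) ^ (j + 1)) • a) U₀) j y)
        (Rbar (zdBlocking d L) (bgT L (shiftCfg (((L : ℤ) ^ (j + 1)) • a) U₀)) j (shiftCfg (((L : ℤ) ^ (j + 1)) • a) f)
          (blockBase L y))
        (Rbar (zdBlocking d L) (bgT L (shiftCfg (((L : ℤ) ^ (j + 1)) • a) U₀)) j (shiftCfg (((L : ℤ) ^ (j + 1)) • a) f)) =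
      avgStep (blockSites L (y + a)) (fun _ => ((L : ℝ) ^ d)⁻¹) (bgT L U₀ j (y + a))
        (Rbar (zdBlocking d L) (bgT L U₀) j f (blockBase L (y + a))) (Rbar (zdBlocking d L) (bgT L U₀) j f)
    rw [hs]
    have hT : bgT L (shiftCfg (((L : ℤ) ^ j) • ((L : ℤ) • a)) U₀) j y = fun x => bgT L U₀ j (y + a) (x + (L : ℤ) • a) := by
      funext x; exact bgT_shiftCfg L U₀ j a y x
    have hR : Rbar (zdBlocking d L) (bgT L (shiftCfg (((L : ℤ) ^ j) • ((L : ℤ) • a)) U₀)) j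
        (shiftCfg (((L : ℤ) ^ j) • ((L : ℤ) • a)) f) = fun x => Rbar (zdBlocking d L) (bgT L U₀) j f (x + (L : ℤ) • a) := by
      funext x; exact Rbar_bgT_shiftCfg L U₀ j ((L : ℤ) • a) f x
    rw [hT, hR, blockBase_add, avgStep_blockSites_add]

omit [NormOneClass 𝔸] in
/-- **(1.29) ON THE ALL-TORUS CONSTRAINT SETS IS TRANSLATION INVARIANT**: for an `Lᵏ·a`-periodic background `U₀` and a gauge `u` with
`Restr129 L k (torusLam k) U₀ u` (the `k`-th nonlinear averages `R̄₀uᵏ(y) = 1` at every level-`k` site — `Λ_j = ∅` below `k`), the translate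
`t_{Lᵏa}u` satisfies the same. [cite: Balaban1985RegularSpaces, (1.29) p.81, p.77 («Ω_j = T_η»)] -/
theorem restr129_torusLam_shiftCfg {L k : ℕ} {U₀ : Site d → Fin d → 𝔸ˣ} {a : Site d}
    (hU₀ : shiftCfg (((L : ℤ) ^ k) • a) U₀ = U₀) {u : Site d → 𝔸ˣ} (h : Restr129 L k (torusLam k) U₀ u) :
    Restr129 L k (torusLam k) U₀ (shiftCfg (((L : ℤ) ^ k) • a) u) := by
  intro j hj y hy
  obtain rfl : j = k := (mem_torusLam_iff k j y).1 hy
  have e : (fun x => ((shiftCfg (((L : ℤ) ^ j) • a) u x : 𝔸ˣ) : 𝔸)) = shiftCfg (((L : ℤ) ^ j) • a) (fun x => ((u x : 𝔸ˣ) : 𝔸)) := rfl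
  rw [e]
  conv_lhs => rw [← hU₀]
  rw [Rbar_bgT_shiftCfg]
  exact h j le_rfl (y + a) (by simp)

/-! ## §4 The covariant stencils under joint translations -/

omit [NormOneClass 𝔸] [CompleteSpace 𝔸] in
/-- `D^η_{t_vU₀,μ}(t_vF)(x) = (D^η_{U₀,μ}F)(x + v)` ((1.1) of [Balaban1985RegularSpaces], forward covariant derivative). [folklore] -/
theorem covDerivFwd_shiftCfg (η : ℝ) (U₀ : Site d → Fin d → 𝔸ˣ) (μ : Fin d) (F : Site d → 𝔸) (v x : Site d) :
    covDerivFwd η (shiftCfg v U₀) μ (shiftCfg v F) x = covDerivFwd η U₀ μ F (x + v) := by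
  simp only [covDerivFwd, shiftCfg_apply, add_right_comm x (e μ) v]

omit [NormOneClass 𝔸] [CompleteSpace 𝔸] in
/-- `D^{η*}_{t_vU₀,ν}(t_vF)(x) = (D^{η*}_{U₀,ν}F)(x + v)` ((1.1) of [Balaban1985RegularSpaces], backward covariant derivative). [folklore] -/
theorem covDeriv_shiftCfg (η : ℝ) (U₀ : Site d → Fin d → 𝔸ˣ) (ν : Fin d) (F : Site d → 𝔸) (v x : Site d) :
    covDeriv η (shiftCfg v U₀) ν (shiftCfg v F) x = covDeriv η U₀ ν F (x + v) := by
  simp only [covDeriv, shiftCfg_apply, add_sub_right_comm x v (e ν)]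

omit [NormOneClass 𝔸] [CompleteSpace 𝔸] in
/-- The covariant divergence `D^{η*}_{U₀}A` is jointly translation covariant. [folklore] -/
theorem covDivB_shiftCfg (η : ℝ) (U₀ : Site d → Fin d → 𝔸ˣ) (A : Site d → Fin d → 𝔸) (v x : Site d) :
    covDivB η (shiftCfg v U₀) (shiftCfg v A) x = covDivB η U₀ A (x + v) := by
  unfold covDivB
  refine Finset.sum_congr rfl fun μ _ => ?_
  exact covDeriv_shiftCfg η U₀ μ (fun z => A z μ) v x

omit [NormOneClass 𝔸] [CompleteSpace 𝔸] in
/-- The covariant Laplacian `Δ^η_{U₀} = Σ_μ D^{η*}_{U₀,μ}D^η_{U₀,μ}` is jointly translation covariant. [folklore] -/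
theorem covLap_shiftCfg (η : ℝ) (U₀ : Site d → Fin d → 𝔸ˣ) (f : Site d → 𝔸) (v x : Site d) :
    covLap η (shiftCfg v U₀) (shiftCfg v f) x = covLap η U₀ f (x + v) := by
  unfold covLap
  have e1 : (fun z μ => covDerivFwd η (shiftCfg v U₀) μ (shiftCfg v f) z) =
      shiftCfg v (fun z μ => covDerivFwd η U₀ μ f z) := by
    funext z μ; rw [covDerivFwd_shiftCfg, shiftCfg_apply]
  rw [e1, covDivB_shiftCfg]

omit [NormOneClass 𝔸] in
/-- The exponential chart `e^{iηA}` is translation covariant: `e^{iη t_vA} = t_v e^{iηA}` (bondwise definition). [folklore] -/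
theorem cfgExp_shiftCfg (η : ℝ) (A : Site d → Fin d → 𝔸) (v : Site d) : cfgExp η (shiftCfg v A) = shiftCfg v (cfgExp η A) := rfl

/-! ## §5 The transpose averaging `Q′(U₀)ᵀ` and (1.38) on `Ω₀ = ℤᵈ` with the all-torus constraint sets -/

omit [NormOneClass 𝔸] in
/-- One transpose step of the linearised averaging ([Balaban1985BackgroundPropagators] (3.19)) is translation covariant: a level-`(j+1)` function
translated by `a`, background translated by `Lʲ·(L·a)`, gives the level-`j` function translated by `L·a` (`L ≥ 1`). [folklore] -/
theorem qprimeT1_shiftCfg {L : ℕ} (hL : 1 ≤ L) (U₀ : Site d → Fin d → 𝔸ˣ) (j : ℕ) (a : Site d) (ν : Site d → 𝔸) (x : Site d) :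
    qprimeT1 L (shiftCfg (((L : ℤ) ^ j) • ((L : ℤ) • a)) U₀) j (shiftCfg a ν) x = qprimeT1 L U₀ j ν (x + (L : ℤ) • a) := by
  unfold qprimeT1
  rw [blockMap_add_smul hL, bgT_shiftCfg, shiftCfg_apply]

omit [NormOneClass 𝔸] in
/-- **`Q′_j(U₀)ᵀ` is translation covariant**: `Q′_j(t_{Lʲa}U₀)ᵀ(t_aν)(x) = Q′_j(U₀)ᵀν(x + Lʲa)` (`L ≥ 1`). [folklore] -/
theorem QprimeT_shiftCfg {L : ℕ} (hL : 1 ≤ L) (U₀ : Site d → Fin d → 𝔸ˣ) :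
    ∀ (j : ℕ) (a : Site d) (ν : Site d → 𝔸) (x : Site d),
      QprimeT L (shiftCfg (((L : ℤ) ^ j) • a) U₀) j (shiftCfg a ν) x = QprimeT L U₀ j ν (x + ((L : ℤ) ^ j) • a)
  | 0, a, ν, x => by simp [QprimeT, shiftCfg_apply]
  | j + 1, a, ν, x => by
    have hs : ((L : ℤ) ^ (j + 1)) • a = ((L : ℤ) ^ j) • ((L : ℤ) • a) := by rw [smul_smul, ← pow_succ]
    rw [hs]
    show QprimeT L (shiftCfg (((L : ℤ) ^ j) • ((L : ℤ) • a)) U₀) j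
        (qprimeT1 L (shiftCfg (((L : ℤ) ^ j) • ((L : ℤ) • a)) U₀) j (shiftCfg a ν)) x =
      QprimeT L U₀ j (qprimeT1 L U₀ j ν) (x + ((L : ℤ) ^ j) • ((L : ℤ) • a))
    have e1 : qprimeT1 L (shiftCfg (((L : ℤ) ^ j) • ((L : ℤ) • a)) U₀) j (shiftCfg a ν) =
        shiftCfg ((L : ℤ) • a) (qprimeT1 L U₀ j ν) := by
      funext z; rw [qprimeT1_shiftCfg hL, shiftCfg_apply]
    rw [e1, QprimeT_shiftCfg hL U₀ j ((L : ℤ) • a) (qprimeT1 L U₀ j ν) x]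

omit [NormOneClass 𝔸] in
/-- **`Q′(U₀)ᵀμ` ON THE ALL-TORUS CONSTRAINT SETS IS TRANSLATION COVARIANT**: for an `Lᵏ·a`-periodic background and any multiplier family
`μ`, the level-wise translated family `μ′_j = t_{L^{k−j}a}μ_j` has `Q′(U₀)ᵀμ′(x) = Q′(U₀)ᵀμ(x + Lᵏa)` (the sets `Λ_j ∈ {∅, ℤᵈ}` of `torusLam`
are translation invariant; `L ≥ 1`). [folklore] -/
theorem QT_torusLam_shiftCfg {L : ℕ} (hL : 1 ≤ L) {k : ℕ} {U₀ : Site d → Fin d → 𝔸ˣ} {a : Site d}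
    (hU₀ : shiftCfg (((L : ℤ) ^ k) • a) U₀ = U₀) (μ : ℕ → Site d → 𝔸) (x : Site d) :
    QT L k (torusLam k) U₀ (fun j => shiftCfg (((L : ℤ) ^ (k - j)) • a) (μ j)) x =
      QT L k (torusLam k) U₀ μ (x + ((L : ℤ) ^ k) • a) := by
  unfold QT
  refine Finset.sum_congr rfl fun j hj => ?_
  have hjk : j ≤ k := Nat.lt_succ_iff.1 (Finset.mem_range.1 hj)
  have hind : (torusLam (d := d) k j).indicator (shiftCfg (((L : ℤ) ^ (k - j)) • a) (μ j)) =
      shiftCfg (((L : ℤ) ^ (k - j)) • a) ((torusLam (d := d) k j).indicator (μ j)) := by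
    by_cases h : j = k
    · subst h; simp
    · rw [B8Thm4TorusAt.torusLam_of_ne h]; simp; rfl
  have hsplit : ((L : ℤ) ^ k) • a = ((L : ℤ) ^ j) • (((L : ℤ) ^ (k - j)) • a) := by
    rw [smul_smul, ← pow_add, Nat.add_sub_cancel' hjk]
  rw [hind]
  conv_lhs => rw [← hU₀, hsplit]
  rw [QprimeT_shiftCfg hL, ← hsplit]

omit [NormOneClass 𝔸] [CompleteSpace 𝔸] in
/-- Functional form of `covDivB_shiftCfg`: `D^{η*}_{t_vU₀}(t_vA) = t_v(D^{η*}_{U₀}A)`. [folklore] -/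
theorem covDivB_shiftCfg_eq (η : ℝ) (U₀ : Site d → Fin d → 𝔸ˣ) (A : Site d → Fin d → 𝔸) (v : Site d) :
    covDivB η (shiftCfg v U₀) (shiftCfg v A) = shiftCfg v (covDivB η U₀ A) := by
  funext x; rw [covDivB_shiftCfg, shiftCfg_apply]

omit [NormOneClass 𝔸] in
/-- **(1.38) ON `Ω₀ = ℤᵈ` WITH THE ALL-TORUS CONSTRAINT SETS IS TRANSLATION INVARIANT**: for an `Lᵏ·a`-periodic background `U₀`, if
`R(U₀)D^{η*}_{U₀}A = 0` in multiplier form (`IsLandau138 L k η univ (torusLam k) U₀ A`) then the same holds for the translate `t_{Lᵏa}A`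
(with the level-wise translated multiplier). [cite: Balaban1985RegularSpaces, (1.38) p.82, p.77 («Ω_j = T_η»); Balaban1985BackgroundPropagators, (3.24)–(3.25) p.394] -/
theorem isLandau138_torusLam_shiftCfg {L : ℕ} (hL : 1 ≤ L) {k : ℕ} {η : ℝ} {U₀ : Site d → Fin d → 𝔸ˣ} {a : Site d}
    (hU₀ : shiftCfg (((L : ℤ) ^ k) • a) U₀ = U₀) {A : Site d → Fin d → 𝔸}
    (h : IsLandau138 L k η Set.univ (torusLam k) U₀ A) :
    IsLandau138 L k η Set.univ (torusLam k) U₀ (shiftCfg (((L : ℤ) ^ k) • a) A) := by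
  obtain ⟨μ, hμ⟩ := h
  refine ⟨fun j => shiftCfg (((L : ℤ) ^ (k - j)) • a) (μ j), fun x _ => ?_⟩
  rw [QT_torusLam_shiftCfg hL hU₀, Set.indicator_univ, ← hμ (x + ((L : ℤ) ^ k) • a) (Set.mem_univ _), Set.indicator_univ]
  conv_lhs => rw [← hU₀]
  rw [covDivB_shiftCfg_eq, covLap_shiftCfg]

end

end Summit.QuantumFields.YangMills.BalabanUVNodes.N16.TorusShift
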